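import Mathlib
import HarnessLib

/-!
# `NoHeavyLowerTail` (crux stmt-CriticalPhenomena-4575), antithetic vdBHK programme: the WEIGHTED COVER LEMMA for antipodal-Kleitman structures

Support file (seat `prim-ineq-gen-7` gen 19; `--supports stmt-CriticalPhenomena-4575`).  Nothing is asserted about the crux; no `sorry`,
no definitions.  Memo: run/shared/lean/prim/prim-ineq-gen-7/FINDING-LEX-g19.md §3–§4.

SETTING (as in `…KnQuestion8AntitheticProduct`, section `AntipodalKleitman`).  A finite preordered type with a weight `μ ≥ 0` and a self-map
`ι` is *antipodal Kleitman* (AK) if `Σ_u μ u · f u · (g u − g (ι u)) ≥ 0` for all monotone `f, g`.  MASTER⁺ for a two-terminal graph is AK of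
its frame poset.  Gen 17/18 gave the block tools T1–T8 (products, ι-invariant partitions, comparable pairs, polar gluing, near-ordinal sums).
This file adds tool **T10 (weighted covers)**, the device behind the THICK-LEAF REDUCTION THEOREM of the memo
(`MASTER⁺(Q;v,t) ∧ LEX(Q;v,t) ⟹ MASTER⁺(x =(k)= v + Q; x,t)` for every `k ≥ 1`):

* `AntitheticCover.cover_pushforward` — if `π : Π → Ω` is monotone and intertwines the self-maps (`π ∘ ι_Π = ι ∘ π`) and `Π` is AK, then
  `Σ_p μ_Π p · f(π p) · (g(π p) − g(ι (π p))) ≥ 0` for all monotone `f, g` on `Ω` (pull back and apply AK of `Π`);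
* `AntitheticCover.sum_comp_eq_sum_fiber` — the pulled-back sum is the `Ω`-sum weighted by the fibre masses `c u = Σ_{π p = u} μ_Π p`;
* `AntitheticCover.weightedCover_two_level` — **T10**: if the AK sum over a `ι`-invariant part `M` is `≥ 0` (AK of the block `M`) and for some
  `N ≥ 1` the sum over `M` plus `N` times the sum over `Mᶜ` is `≥ 0` (e.g. a cover with fibre mass `1` on `M` and `N` on `Mᶜ`), then the whole
  structure is AK.  Proof: with `S = S_M + S_X`, if `S_X ≥ 0` then `S ≥ S_M ≥ 0`, else `S ≥ S_M + N·S_X ≥ 0`.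
In the application `Π = 2^k × Ŷ(Q)` (Kleitman cube × the 'linked extension' poset of `Q`, AK by `antipodalKleitman_prod`), `Ω = Ω(x =(k)= v + Q)`,
`M = 2^k × Ω_Q` (fibre mass 1, AK by `antipodalKleitman_prod` and coarsening) and `Mᶜ` = the cross-linked stratum (fibre mass `N = 2^k`).
-/

namespace Summit.CriticalPhenomena.PercolationContinuityZ3.Theorems

open Finset

namespace AntitheticCover

section Pushforward

variable {P Ω : Type*} [Fintype P]

/-- **Pull-back along an equivariant monotone map.**  If `Π` is antipodal Kleitman (for `μP, ιP`) and `π : Π → Ω` is monotone with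
`π (ιP p) = ι (π p)`, then for all monotone `f, g : Ω → ℝ` the pulled-back AK sum is nonnegative. [this work] -/
theorem cover_pushforward [Preorder P] [Preorder Ω] (μP : P → ℝ) (ιP : P → P) (ι : Ω → Ω) (π : P → Ω) (hπ : Monotone π)
    (hπι : ∀ p, π (ιP p) = ι (π p))
    (hAK : ∀ F G : P → ℝ, Monotone F → Monotone G → 0 ≤ ∑ p, μP p * (F p * (G p - G (ιP p))))
    (f g : Ω → ℝ) (hf : Monotone f) (hg : Monotone g) :
    0 ≤ ∑ p, μP p * (f (π p) * (g (π p) - g (ι (π p)))) := by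
  have h := hAK (f ∘ π) (g ∘ π) (hf.comp hπ) (hg.comp hπ)
  simpa [Function.comp, hπι] using h

/-- **Fibre masses.**  `Σ_p μP p · H (π p) = Σ_u (Σ_{p : π p = u} μP p) · H u`. [this work] -/
theorem sum_comp_eq_sum_fiber [Fintype Ω] [DecidableEq Ω] (μP : P → ℝ) (π : P → Ω) (H : Ω → ℝ) :
    ∑ p, μP p * H (π p) = ∑ u, (∑ p ∈ univ.filter (fun p => π p = u), μP p) * H u := by
  classical
  rw [← Finset.sum_fiberwise_of_maps_to (s := (univ : Finset P)) (t := (univ : Finset Ω)) (g := π) (fun p _ => mem_univ _)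
    (fun p => μP p * H (π p))]
  refine Finset.sum_congr rfl (fun u _ => ?_)
  rw [Finset.sum_mul]
  refine Finset.sum_congr rfl (fun p hp => ?_)
  rw [(Finset.mem_filter.1 hp).2]

end Pushforward

section TwoLevel

variable {Ω : Type*} [Fintype Ω] [Preorder Ω]

/-- **T10, the weighted cover lemma (two levels).**  Let `M ⊆ Ω` (membership decidable), `μ ≥ 0`, `ι : Ω → Ω`.  Suppose
(i) the block `M` is antipodal Kleitman: `Σ_{u ∈ M} μ u f u (g u − g (ι u)) ≥ 0` for all monotone `f, g` on `Ω`, and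
(ii) for some `N ≥ 1`: `Σ_{u ∈ M} μ u f u (g u − g(ι u)) + N · Σ_{u ∉ M} μ u f u (g u − g(ι u)) ≥ 0` for all monotone `f, g`
(typically obtained from `cover_pushforward` + `sum_comp_eq_sum_fiber` for a cover with fibre mass `μ` on `M` and `N·μ` off `M`).
Then `Ω` is antipodal Kleitman. [this work] -/
theorem weightedCover_two_level (M : Set Ω) [DecidablePred (· ∈ M)] (μ : Ω → ℝ) (ι : Ω → Ω) (N : ℝ) (hN : 1 ≤ N)
    (hM : ∀ f g : Ω → ℝ, Monotone f → Monotone g →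
      0 ≤ ∑ u ∈ univ.filter (fun u => u ∈ M), μ u * (f u * (g u - g (ι u))))
    (hcov : ∀ f g : Ω → ℝ, Monotone f → Monotone g →
      0 ≤ (∑ u ∈ univ.filter (fun u => u ∈ M), μ u * (f u * (g u - g (ι u))))
        + N * (∑ u ∈ univ.filter (fun u => ¬ u ∈ M), μ u * (f u * (g u - g (ι u)))))
    (f g : Ω → ℝ) (hf : Monotone f) (hg : Monotone g) :
    0 ≤ ∑ u, μ u * (f u * (g u - g (ι u))) := by
  set SM := ∑ u ∈ univ.filter (fun u => u ∈ M), μ u * (f u * (g u - g (ι u))) with hSM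
  set SX := ∑ u ∈ univ.filter (fun u => ¬ u ∈ M), μ u * (f u * (g u - g (ι u))) with hSX
  have hsplit : ∑ u, μ u * (f u * (g u - g (ι u))) = SM + SX := by
    rw [hSM, hSX, ← Finset.sum_filter_add_sum_filter_not (univ : Finset Ω) (fun u => u ∈ M)]
  have h1 : 0 ≤ SM := hM f g hf hg
  have h2 : 0 ≤ SM + N * SX := hcov f g hf hg
  rw [hsplit]
  by_cases hX : 0 ≤ SX
  · linarith
  · have hX' : SX < 0 := lt_of_not_ge hX
    have : N * SX ≤ SX := by nlinarith
    linarith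

/-- **T10, general form (finitely many levels by induction is not needed in the applications; this is the convenient 'monotone weight' corollary):**
if `c : Ω → ℝ` takes only the values `1` (on `M`) and `N ≥ 1` (off `M`), the `c`-weighted AK sum is `≥ 0` for all monotone `f, g`, and the
block `M` is AK, then `Ω` is AK. [this work] -/
theorem weightedCover_of_weight (M : Set Ω) [DecidablePred (· ∈ M)] (μ c : Ω → ℝ) (ι : Ω → Ω) (N : ℝ) (hN : 1 ≤ N)
    (hc1 : ∀ u, u ∈ M → c u = 1) (hcN : ∀ u, u ∉ M → c u = N)
    (hM : ∀ f g : Ω → ℝ, Monotone f → Monotone g →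
      0 ≤ ∑ u ∈ univ.filter (fun u => u ∈ M), μ u * (f u * (g u - g (ι u))))
    (hcov : ∀ f g : Ω → ℝ, Monotone f → Monotone g → 0 ≤ ∑ u, c u * μ u * (f u * (g u - g (ι u))))
    (f g : Ω → ℝ) (hf : Monotone f) (hg : Monotone g) :
    0 ≤ ∑ u, μ u * (f u * (g u - g (ι u))) := by
  refine weightedCover_two_level M μ ι N hN hM ?_ f g hf hg
  intro f' g' hf' hg'
  have h := hcov f' g' hf' hg'
  rw [← Finset.sum_filter_add_sum_filter_not (univ : Finset Ω) (fun u => u ∈ M)] at h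
  have eM : ∑ u ∈ univ.filter (fun u => u ∈ M), c u * μ u * (f' u * (g' u - g' (ι u)))
      = ∑ u ∈ univ.filter (fun u => u ∈ M), μ u * (f' u * (g' u - g' (ι u))) := by
    refine Finset.sum_congr rfl (fun u hu => ?_)
    rw [hc1 u (Finset.mem_filter.1 hu).2, one_mul]
  have eX : ∑ u ∈ univ.filter (fun u => ¬ u ∈ M), c u * μ u * (f' u * (g' u - g' (ι u)))
      = N * ∑ u ∈ univ.filter (fun u => ¬ u ∈ M), μ u * (f' u * (g' u - g' (ι u))) := by
    rw [Finset.mul_sum]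
    refine Finset.sum_congr rfl (fun u hu => ?_)
    rw [hcN u (Finset.mem_filter.1 hu).2, mul_assoc]
  rw [eM, eX] at h
  exact h

end TwoLevel

end AntitheticCover

end Summit.CriticalPhenomena.PercolationContinuityZ3.Theorems
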